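import Summits.BirchSwinnertonDyer.BirchSwinnertonDyer.Theses.PrintCf2
import Summits.BirchSwinnertonDyer.BirchSwinnertonDyer.Theorems.PrintCf2RamifiedOffTYZLowerHalfRhoOneOfFacts
import HarnessLib

/-!
# Closer of the route-A aside `PrintCf2.RamifiedLowerHalfRhoOneOddOfFacts` (stmt-BirchSwinnertonDyer-23304)

Summit `BirchSwinnertonDyer`, route `PrintCf2` rev 47 (planner g21), crux `PrintCf2.RamifiedOffTYZOfFacts`
(stmt-BirchSwinnertonDyer-20509) / parent `RamifiedJumpOneLevelTwoOfFacts` (stmt-23431): the `{ρ = 1}` LOWER-HALF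
aside — granted TYZ 2017 §3 AS PRINTED with the Frobenius package, TYZ Thm 1.1 and GZK, for every square-free odd
`n ≡ 5, 7 (mod 8)` with `ord_{s=1} L(E_n, s) = 1`, `#Sel₂(E_n/ℚ) = 2^{2+s}` with `s ≥ 2` and a `ρ = 1` generator, every
Tian–Yuan–Zhang integer `𝓛(n)` is even.  The CONTENT is cruxlead-20509 g11's landed
`Summit.BirchSwinnertonDyer.PrintCf2.LowerHalfRhoOne.two_dvd_scriptL_rhoOne_odd_of_facts` (p729409); this file is the
by-name closer (turnkey `Cruxes/RamifiedOffTYZOfFacts/Lines/offtyz_v7_RhoOneAside.md` § Closer), landed by width seat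
`bsd-line-cf2-p1-w3` g19 on the planner's «any idle prover» call.  The aside is CONDITIONAL on the three named facts in
its own hypothesis (two printed TYZ statements without `_holds`, and GZK); no summit statement is proved; BSD is not proved
by any of this.
-/

-- summit-side namespace `Summit.BirchSwinnertonDyer.BirchSwinnertonDyer.…` (single-conjunct summit, D-0017 layout)
set_option linter.dupNamespace false

namespace Summit.BirchSwinnertonDyer.BirchSwinnertonDyer.Theorems

/-- **Closer of the aside `RamifiedLowerHalfRhoOneOddOfFacts`** (route `PrintCf2`, stmt-BirchSwinnertonDyer-23304): the route
declaration, proved BY NAME by cruxlead-20509 g11's `LowerHalfRhoOne.two_dvd_scriptL_rhoOne_odd_of_facts`.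
[cite: TianYuanZhang2017, Thm. 1.1, §1 (ρ(n)), §3] [cite: HeathBrown1994SelmerCongruentII, Monsky appendix] [cite: Darmon2004, GZK] -/
theorem ramifiedLowerHalfRhoOneOddOfFacts_proof :
    Summit.BirchSwinnertonDyer.BirchSwinnertonDyer.Theses.PrintCf2.RamifiedLowerHalfRhoOneOddOfFacts :=
  Summit.BirchSwinnertonDyer.PrintCf2.LowerHalfRhoOne.two_dvd_scriptL_rhoOne_odd_of_facts

end Summit.BirchSwinnertonDyer.BirchSwinnertonDyer.Theorems
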